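import Mathlib
import Summits.NavierStokesRegularity.NavierStokesRegularity.Theorems.HeteroclinicTriggerChainTriggerChainFrontStepForcedDelay
import Summits.NavierStokesRegularity.NavierStokesRegularity.Theorems.HeteroclinicTriggerChainTriggerChainFrontStepFlowWindows
import HarnessLib

/-!
# `HeteroclinicTriggerChain` — crux `TriggerChainFrontStep` (item stmt-NavierStokesRegularity-22785):
  the IGNITION TIME of the forced arc, composed (delay phase + first hitting time)

Composition of `…ForcedDelay` with the hitting-time plumbing of `…FlowWindows` into the statement the
lifespan pinch needs for the pre-ignition part of a hop. Setting: on `[0,T]` (derivatives within the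
segment) `D′ = −2e·u² + f₁`, `u′ = e·D·u + f₂`, `|f₁| ≤ φ₁`, `|f₂| ≤ φ₂`, a sub-threshold positive seed
`φ₂/(eD₋) < u(0)`, `|u(0)| < h`, and carrier bounds `0 < D₋ ≤ D(0) − (2eh² + φ₁)T`, `D(0) + φ₁T ≤ D₊`.
If the delay law allows ignition within the window — `h ≤ (u(0) − φ₂/(eD₋))·e^{eD₋T₁}` for some
`T₁ ≤ T` — then (`heteroclinicTriggerChain_forcedArcOn_ignition_time`) there is a FIRST time
`τ ∈ (0, T₁]` with `u(τ) = h`, `|u| < h` on `[0,τ)`, the carrier pinned `D₋ ≤ D ≤ D₊` on `[0,τ]`, and the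
two-sided growth on `[0,τ]` (so `τ ≥ log(h/(|u(0)| + φ₂/(eD₊)))/(eD₊)` as well): the `log(1/seed)/e`
delay law with forcing, as an existence statement.

HONEST FRAMING: elementary real analysis of a planar ODE with bounded forcing on a segment; helper lemma
for the crux (no stub credit); nothing here is a statement about the Navier–Stokes equations; no summit,
rung or crux is proved by this file.
-/

noncomputable section

set_option linter.dupNamespace false

open Real Set

namespace Summit.NavierStokesRegularity.NavierStokesRegularity.Theorems

/-- **Ignition time of the forced arc.** See the module docstring. [this file] -/
theorem heteroclinicTriggerChain_forcedArcOn_ignition_time {e φ₁ φ₂ h Dm Dp T T₁ : ℝ}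
    {D u f₁ f₂ : ℝ → ℝ} (he : 0 < e) (hT₁ : 0 ≤ T₁) (hT₁T : T₁ ≤ T)
    (hD : ∀ t ∈ Icc 0 T, HasDerivWithinAt D (-(2 * e * u t ^ 2) + f₁ t) (Icc 0 T) t)
    (hu : ∀ t ∈ Icc 0 T, HasDerivWithinAt u (e * D t * u t + f₂ t) (Icc 0 T) t)
    (hf₁ : ∀ t ∈ Icc 0 T, |f₁ t| ≤ φ₁) (hf₂ : ∀ t ∈ Icc 0 T, |f₂ t| ≤ φ₂)
    (hDm : 0 < Dm) (hDmle : Dm ≤ D 0 - (2 * e * h ^ 2 + φ₁) * T) (hDp : D 0 + φ₁ * T ≤ Dp)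
    (hfl : φ₂ / (e * Dm) < u 0) (huh0 : |u 0| < h)
    (hreach : h ≤ (u 0 - φ₂ / (e * Dm)) * Real.exp (e * Dm * T₁)) :
    ∃ τ ∈ Ioc 0 T₁, u τ = h ∧ (∀ t ∈ Ico 0 τ, |u t| < h) ∧
      (∀ t ∈ Icc 0 τ, Dm ≤ D t ∧ D t ≤ Dp) ∧
      (∀ t ∈ Icc 0 τ, (u 0 - φ₂ / (e * Dm)) * Real.exp (e * Dm * t) + φ₂ / (e * Dm) ≤ u t ∧
        |u t| ≤ |u 0| * Real.exp (e * Dp * t) + φ₂ / (e * Dp) * (Real.exp (e * Dp * t) - 1)) := by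
  have hT : 0 ≤ T := hT₁.trans hT₁T
  have hφ₁ : 0 ≤ φ₁ := (abs_nonneg _).trans (hf₁ 0 ⟨le_rfl, hT⟩)
  have hφ₂ : 0 ≤ φ₂ := (abs_nonneg _).trans (hf₂ 0 ⟨le_rfl, hT⟩)
  have hh : 0 < h := lt_of_le_of_lt (abs_nonneg _) huh0
  have hDp0 : 0 < Dp := by
    have : 0 ≤ (2 * e * h ^ 2 + φ₁) * T := by positivity
    have : 0 ≤ φ₁ * T := by positivity
    linarith
  -- restriction of the arc to a sub-window [0, S]
  have restrD : ∀ {S : ℝ}, S ≤ T → ∀ t ∈ Icc 0 S,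
      HasDerivWithinAt D (-(2 * e * u t ^ 2) + f₁ t) (Icc 0 S) t := fun hS t ht =>
    (hD t ⟨ht.1, ht.2.trans hS⟩).mono (Icc_subset_Icc_right hS)
  have restrU : ∀ {S : ℝ}, S ≤ T → ∀ t ∈ Icc 0 S,
      HasDerivWithinAt u (e * D t * u t + f₂ t) (Icc 0 S) t := fun hS t ht =>
    (hu t ⟨ht.1, ht.2.trans hS⟩).mono (Icc_subset_Icc_right hS)
  -- on any sub-window where |u| ≤ h the carrier is pinned
  have hpin : ∀ {S : ℝ}, S ≤ T → (∀ t ∈ Icc 0 S, |u t| ≤ h) →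
      ∀ t ∈ Icc 0 S, Dm ≤ D t ∧ D t ≤ Dp := by
    intro S hS huh t ht
    have hw := heteroclinicTriggerChain_forcedDelayOn_carrier_window he.le (restrD hS)
      (fun t ht => hf₁ t ⟨ht.1, ht.2.trans hS⟩) huh t ht
    have h1 : (2 * e * h ^ 2 + φ₁) * t ≤ (2 * e * h ^ 2 + φ₁) * T :=
      mul_le_mul_of_nonneg_left (ht.2.trans hS) (by positivity)
    have h2 : φ₁ * t ≤ φ₁ * T := mul_le_mul_of_nonneg_left (ht.2.trans hS) hφ₁
    exact ⟨by linarith [hw.1], by linarith [hw.2]⟩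
  -- Step A: some time in [0, T₁] has |u| ≥ h
  have hA : ∃ t₁ ∈ Icc 0 T₁, h ≤ |u t₁| := by
    by_contra hcon
    push Not at hcon
    have huh : ∀ t ∈ Icc 0 T₁, |u t| ≤ h := fun t ht => (hcon t ht).le
    have hDD : ∀ t ∈ Icc 0 T₁, Dm ≤ D t := fun t ht => (hpin hT₁T huh t ht).1
    have hign := heteroclinicTriggerChain_forcedDelayOn_ignition he hDm hT₁ (restrU hT₁T)
      (fun t ht => hf₂ t ⟨ht.1, ht.2.trans hT₁T⟩) hDD hfl hreach
    have := hcon T₁ (right_mem_Icc.2 hT₁)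
    linarith [le_abs_self (u T₁)]
  obtain ⟨t₁, ht₁, ht₁h⟩ := hA
  -- Step B: the first hitting time of h by |u| on [0, t₁]
  have hcont : ContinuousOn (fun t => |u t|) (Icc 0 t₁) := fun t ht =>
    ((hu t ⟨ht.1, ht.2.trans (ht₁.2.trans hT₁T)⟩).continuousWithinAt.mono
      (Icc_subset_Icc_right (ht₁.2.trans hT₁T))).abs
  obtain ⟨τ, hτ, hτh, hbefore⟩ := htcFW_first_hitting_time ht₁.1 hcont huh0 ht₁h
  have hτT : τ ≤ T := hτ.2.trans (ht₁.2.trans hT₁T)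
  -- Step C: on [0, τ] the trigger stays below h, the carrier is pinned, the growth is two-sided
  have huhτ : ∀ t ∈ Icc 0 τ, |u t| ≤ h := by
    intro t ht
    rcases lt_or_eq_of_le ht.2 with hlt | heq
    · exact (hbefore t ⟨ht.1, hlt⟩).le
    · rw [heq]; exact hτh.le
  have hpinτ := hpin hτT huhτ
  have hlow := heteroclinicTriggerChain_forcedDelayOn_growth_lower he hDm (restrU hτT)
    (fun t ht => hf₂ t ⟨ht.1, ht.2.trans hτT⟩) (fun t ht => (hpinτ t ht).1) hfl
  have hupp := heteroclinicTriggerChain_forcedDelayOn_growth_upper he hDp0 (restrU hτT)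
    (fun t ht => hf₂ t ⟨ht.1, ht.2.trans hτT⟩)
    (fun t ht => by
      have h := hpinτ t ht
      rw [abs_of_pos (hDm.trans_le h.1)]; exact h.2)
  -- u τ = +h
  have huτ : u τ = h := by
    have hpos : 0 < u τ := by
      have h1 := hlow τ (right_mem_Icc.2 hτ.1.le)
      have hgap : 0 < u 0 - φ₂ / (e * Dm) := by linarith
      have : 0 < (u 0 - φ₂ / (e * Dm)) * Real.exp (e * Dm * τ) := mul_pos hgap (Real.exp_pos _)
      have : 0 ≤ φ₂ / (e * Dm) := div_nonneg hφ₂ (mul_pos he hDm).le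
      linarith
    rw [← abs_of_pos hpos]; exact hτh
  exact ⟨τ, ⟨hτ.1, hτ.2.trans ht₁.2⟩, huτ, hbefore, hpinτ, fun t ht => ⟨hlow t ht, hupp t ht⟩⟩

end Summit.NavierStokesRegularity.NavierStokesRegularity.Theorems

end
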